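import Summits.HubbardSuperconductivity.HubbardSuperconductivity.Theorems.BalabanIRBirEveryGroundStateSectorPB
import Summits.HubbardSuperconductivity.HubbardSuperconductivity.Theorems.BalabanIRBirEveryGroundStateThermalChord
import HarnessLib

/-!
# Route `BalabanIR`, crux 5 `BirEveryGroundState` (`stmt-HubbardSuperconductivity-2083`):
# EVERY ground state from the THERMAL average of the penalised ensemble — the engine-facing re-cut

Hubbard specialisation of the sector Peierls–Bogoliubov inequality of
`BalabanIRBirEveryGroundStateSectorPB` (`sectorGibbsAverage_sub_le_re_rayleigh_ground`). On the torus
of side `L` let `H = hubbardTorus 2 L 1 U`, `S = szSector (2⌊(1-δ)L²/2⌋) 0` with projection `P_S`,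
`Y_L = L⁻⁴ Δ_d† Δ_d` (which preserves `S`), and for `κ, β > 0` let
`⟨Y_L⟩_{β,κ} = re tr (P_S e^{-β(H + κY_L)} Y_L) / re tr (P_S e^{-β(H + κY_L)})` be the canonical
(sector) Gibbs average of the `d`-wave pair intensity in the PENALISED ensemble.

* `forall_groundState_bound_of_penalisedThermalAverage` — if, eventually in even `L`, SOME
  `κ, β > 0` have `a + L² log 4 / (βκ) ≤ ⟨Y_L⟩_{β,κ}`, then EVERY normalised sector ground state `ψ`
  of the unpenalised `H` has `a L⁴ ≤ re ⟨ψ, Δ_d† Δ_d ψ⟩` (entropy budget `log dim S ≤ L² log 4`,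
  `finrank_szSector_fermionTorus_le`);
* `hasLRO_of_penalisedThermalAverage` — hence the summit's every-ground-state `d_{x²-y²}` pair-field
  LRO at `(U, δ)`;
* `birEveryGroundState_structural_of_penalisedThermalAverage` — the item's body, verbatim and
  route-file-free, from "window average ⇒ penalised thermal average at one coupling" (socket);
* `hubbardSuperconductivity_of_penalisedThermalAverage` / `penalisedThermalAverageSummit` — THE
  ENGINE-FACING RE-CUT: a lower bound `⟨Y_L⟩_{β_L,κ} ≥ 2a` on the thermal, sector-canonical `d`-wave
  pair intensity of the κ-penalised Hubbard torus at ONE `(δ, U)`, one fixed small `κ > 0` and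
  inverse temperatures `β_L ≥ L² log 4 / (κ a)` (deep inside a functional-integral engine's
  `M ≫ L²` regime), gives `HubbardSuperconductivity` — no window of couplings, no genericity crux,
  no zero-temperature limit. This is the same KIND of statement as the route's target (a
  volume-uniform lower bound on the averaged pair correlation), for the slightly perturbed
  Hamiltonian `H + κ Y_L` (‖κ Y_L‖ = O(κ)) at finite `β`.

Relation to the other closers of this seat: `Theorems.hasLRO_of_thermalChord` (free-energy
increment `log Z_S(H) - log Z_S(H + κY_L) ≥ βκa + L² log 4`) is implied by the present hypothesis
through `mul_sectorGibbsAverage_le_log_sub_log`; `Theorems.hasLRO_of_shiftedAverage` is its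
zero-temperature form (ground-state average of the penalised Hamiltonian).

This module imports NO route file (rev-5 materialisation rule). Sources: B. Simon, *The Statistical
Mechanics of Lattice Gases* I (1993) §II.13; Griffiths, J. Math. Phys. 5 (1964) 1215 §III;
Scalapino, Phys. Rep. 250 (1995) 329 §2; Koma–Tasaki, PRL 68 (1992) 3248 (no `T > 0` order in two
dimensions — consistent, since `β_L → ∞` with `L`). Folklore; no definition is introduced.
-/

noncomputable section

open scoped Matrix.Norms.L2Operator ComplexOrder MatrixOrder InnerProductSpace

namespace Summit.HubbardSuperconductivity.HubbardSuperconductivity.Theorems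

open Matrix Finset Filter Literature.MathematicalPhysics.QuantumLattice
open Literature.Probability.LatticeModels

section Hubbard

/-- **EVERY GROUND STATE FROM THE PENALISED THERMAL AVERAGE (one coupling).** Fix `U`, `δ`, `a`
and `L₀`. Suppose that at every even side `L ≥ L₀` there are SOME `κ, β > 0` with
`a + L² log 4 / (βκ) ≤ ⟨Y_L⟩_{β,κ}`, the sector Gibbs average of `Y_L = L⁻⁴ Δ_d† Δ_d` in the penalised
ensemble `hubbardTorus 2 L 1 U + κ Y_L` (sector `(2⌊(1-δ)L²/2⌋, S^z = 0)`). Then every normalised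
sector ground state `ψ` of `hubbardTorus 2 L 1 U` at every even `L ≥ L₀` has
`a L⁴ ≤ re ⟨ψ, Δ_d† Δ_d ψ⟩` (`sectorGibbsAverage_sub_le_re_rayleigh_ground` with the budget
`log dim S ≤ L² log 4`). B. Simon (1993) §II.13; Scalapino (1995) §2. [folklore] -/
theorem forall_groundState_bound_of_penalisedThermalAverage (U δ a : ℝ) (L₀ : ℕ)
    (h : ∀ (L : ℕ) [NeZero L], L₀ ≤ L → Even L → ∃ κ β : ℝ, 0 < κ ∧ 0 < β ∧
      let N : ℕ := 2 * ⌊(1 - δ) * (L : ℝ) ^ 2 / 2⌋₊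
      let H := hubbardTorus 2 L 1 U
      let S := szSector (Λ := FermionTorus 2 L) N 0
      let PS := projMatrix (S.map (Fock.toEuclidean (ι := Orb (FermionTorus 2 L)) :
        Fock (Orb (FermionTorus 2 L)) →ₗ[ℂ] EuclideanSpace ℂ (Finset (Orb (FermionTorus 2 L)))))
      let Yd : Matrix (Finset (Orb (FermionTorus 2 L))) (Finset (Orb (FermionTorus 2 L))) ℂ :=
        ((1 : ℂ) / (L : ℂ) ^ 4) • ((pairField dWaveFormFactor L)ᴴ * pairField dWaveFormFactor L)
      a + (L : ℝ) ^ 2 * Real.log 4 / (β * κ) ≤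
        (PS * gibbsWeight β (H + (κ : ℂ) • Yd) * Yd).trace.re /
          (PS * gibbsWeight β (H + (κ : ℂ) • Yd)).trace.re) :
    ∀ (L : ℕ) [NeZero L], L₀ ≤ L → Even L → ∀ ψ : Fock (Orb (FermionTorus 2 L)),
      IsGroundStateInSector (hubbardTorus 2 L 1 U) (2 * ⌊(1 - δ) * (L : ℝ) ^ 2 / 2⌋₊) 0 ψ →
      star ψ ⬝ᵥ ψ = 1 →
      a * (L : ℝ) ^ 4 ≤
        (star ψ ⬝ᵥ ((pairField dWaveFormFactor L)ᴴ * pairField dWaveFormFactor L) *ᵥ ψ).re := by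
  intro L _ hL hLe ψ hgs hψ
  obtain ⟨κ, β, hκ, hβ, hyp⟩ := h L hL hLe
  simp only at hyp
  set A : Matrix (Finset (Orb (FermionTorus 2 L))) (Finset (Orb (FermionTorus 2 L))) ℂ :=
    (pairField dWaveFormFactor L)ᴴ * pairField dWaveFormFactor L with hA
  set H := hubbardTorus 2 L 1 U with hH
  set S := szSector (Λ := FermionTorus 2 L) (2 * ⌊(1 - δ) * (L : ℝ) ^ 2 / 2⌋₊) 0 with hS
  set Yd : Matrix (Finset (Orb (FermionTorus 2 L))) (Finset (Orb (FermionTorus 2 L))) ℂ :=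
    ((1 : ℂ) / (L : ℂ) ^ 4) • A with hYd
  -- the data of the abstract closer
  have hHh : H.IsHermitian := LiebThm1.hamiltonian_isHermitian (fermionTorusGraph 2 L) 1 U
  have hAh : A.IsHermitian := isHermitian_conjTranspose_mul_self _
  have hYdh : Yd.IsHermitian := by
    refine hAh.smul ?_
    rw [isSelfAdjoint_iff, Complex.star_def, map_div₀, map_one, map_pow, Complex.conj_natCast]
  have hinvH : ∀ v ∈ S, H *ᵥ v ∈ S := fun v hv => szSector_invariant_hubbardTorus 2 L 1 U _ hv
  have hinvY : ∀ v ∈ S, Yd *ᵥ v ∈ S := by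
    intro v hv
    rw [hYd, smul_mulVec]
    exact S.smul_mem _ (pairIntensity_mulVec_mem_szSector L _ hv)
  set PS := projMatrix (S.map (Fock.toEuclidean (ι := Orb (FermionTorus 2 L)) :
    Fock (Orb (FermionTorus 2 L)) →ₗ[ℂ] EuclideanSpace ℂ (Finset (Orb (FermionTorus 2 L))))) with hPS
  -- the abstract closer (its projection is written along `WithLp.linearEquiv.symm = toEuclidean`)
  have key : (PS * gibbsWeight β (H + (κ : ℂ) • Yd) * Yd).trace.re /
        (PS * gibbsWeight β (H + (κ : ℂ) • Yd)).trace.re -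
        Real.log (Module.finrank ℂ S) / (β * κ) ≤ (star ψ ⬝ᵥ Yd *ᵥ ψ).re :=
    sectorGibbsAverage_sub_le_re_rayleigh_ground hHh hYdh S hinvH hinvY hgs.1 hψ hgs.2.2 hκ hβ
  -- the entropy budget `log dim S ≤ L² log 4`
  have hd1 : (1 : ℝ) ≤ Module.finrank ℂ S := by
    have : 0 < Module.finrank ℂ S := Module.finrank_pos_iff_exists_ne_zero.mpr
      ⟨⟨ψ, hgs.1⟩, fun h0 => hgs.2.1 (by simpa using congrArg Subtype.val h0)⟩
    exact_mod_cast this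
  have hbudget : Real.log (Module.finrank ℂ S) ≤ (L : ℝ) ^ 2 * Real.log 4 := by
    have h4 : (Module.finrank ℂ S : ℝ) ≤ (4 : ℝ) ^ (L ^ 2) := by
      exact_mod_cast finrank_szSector_fermionTorus_le L (2 * ⌊(1 - δ) * (L : ℝ) ^ 2 / 2⌋₊) 0
    calc Real.log (Module.finrank ℂ S) ≤ Real.log ((4 : ℝ) ^ (L ^ 2)) :=
          Real.log_le_log (by linarith) h4
      _ = (L : ℝ) ^ 2 * Real.log 4 := by rw [Real.log_pow]; push_cast; ring
  have hβκ : 0 < β * κ := mul_pos hβ hκ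
  have hdiv : Real.log (Module.finrank ℂ S) / (β * κ) ≤ (L : ℝ) ^ 2 * Real.log 4 / (β * κ) :=
    div_le_div_of_nonneg_right hbudget hβκ.le
  have h3 : a ≤ (star ψ ⬝ᵥ Yd *ᵥ ψ).re := by linarith
  -- back to `Δ_d† Δ_d`
  have hL4 : (0 : ℝ) < (L : ℝ) ^ 4 := by
    have : (0 : ℝ) < (L : ℝ) := Nat.cast_pos.mpr (Nat.pos_of_ne_zero (NeZero.ne L))
    positivity
  have hexp : (star ψ ⬝ᵥ Yd *ᵥ ψ).re = (star ψ ⬝ᵥ A *ᵥ ψ).re / (L : ℝ) ^ 4 := by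
    have hcast : ((1 : ℂ) / (L : ℂ) ^ 4) = (((1 : ℝ) / (L : ℝ) ^ 4 : ℝ) : ℂ) := by push_cast; ring
    rw [hYd, smul_mulVec, dotProduct_smul, smul_eq_mul, hcast, Complex.re_ofReal_mul]
    ring
  rw [hexp, le_div_iff₀ hL4] at h3
  exact h3

/-- **Penalised thermal average ⇒ the summit's every-ground-state LRO at `(U, δ)`.** For `δ ≥ -1`:
if at coupling `U` there are `a > 0` and `L₀` such that at every even side `L ≥ L₀` some `κ, β > 0`
have `a + L² log 4 / (βκ) ≤ ⟨Y_L⟩_{β,κ}` (sector Gibbs average of `Y_L = L⁻⁴ Δ_d† Δ_d` in the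
penalised ensemble `hubbardTorus 2 L 1 U + κ Y_L`), then EVERY admissible sequence of normalised
`(2⌊(1-δ)L²/2⌋, S^z = 0)`-sector ground states of `hubbardTorus 2 L 1 U` has `d_{x²-y²}` pair-field
long-range order along the even sides (`forall_groundState_bound_of_penalisedThermalAverage` +
`forall_hasLRO_iff_groundState_bound`). B. Simon (1993) §II.13; Scalapino (1995) §2. [folklore] -/
theorem hasLRO_of_penalisedThermalAverage (U δ : ℝ) (hδ : -1 ≤ δ)
    (h : ∃ a : ℝ, 0 < a ∧ ∃ L₀ : ℕ, ∀ (L : ℕ) [NeZero L], L₀ ≤ L → Even L →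
      ∃ κ β : ℝ, 0 < κ ∧ 0 < β ∧
      let N : ℕ := 2 * ⌊(1 - δ) * (L : ℝ) ^ 2 / 2⌋₊
      let H := hubbardTorus 2 L 1 U
      let S := szSector (Λ := FermionTorus 2 L) N 0
      let PS := projMatrix (S.map (Fock.toEuclidean (ι := Orb (FermionTorus 2 L)) :
        Fock (Orb (FermionTorus 2 L)) →ₗ[ℂ] EuclideanSpace ℂ (Finset (Orb (FermionTorus 2 L)))))
      let Yd : Matrix (Finset (Orb (FermionTorus 2 L))) (Finset (Orb (FermionTorus 2 L))) ℂ :=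
        ((1 : ℂ) / (L : ℂ) ^ 4) • ((pairField dWaveFormFactor L)ᴴ * pairField dWaveFormFactor L)
      a + (L : ℝ) ^ 2 * Real.log 4 / (β * κ) ≤
        (PS * gibbsWeight β (H + (κ : ℂ) • Yd) * Yd).trace.re /
          (PS * gibbsWeight β (H + (κ : ℂ) • Yd)).trace.re) :
    ∀ (N : ℕ → ℕ) (ψ : ∀ L, Fock (Orb (FermionTorus 2 L))),
      (∀ L, Even L → N L = 2 * ⌊(1 - δ) * (L : ℝ) ^ 2 / 2⌋₊ ∧ star (ψ L) ⬝ᵥ ψ L = 1 ∧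
        IsGroundStateInSector (hubbardTorus 2 L 1 U) (N L) 0 (ψ L)) →
      HasLongRangeOrder (fun k => halfOpenBox 2 (2 * k))
        (fun k => torusPullback (pairFieldCorr dWaveFormFactor ψ) (2 * k)) := by
  obtain ⟨a, ha, L₀, hL₀⟩ := h
  exact (forall_hasLRO_iff_groundState_bound U δ hδ).2
    ⟨a, ha, L₀, forall_groundState_bound_of_penalisedThermalAverage U δ a L₀ hL₀⟩

/-- **The body of `Theses.BalabanIR.BirEveryGroundState` (item `stmt-HubbardSuperconductivity-2083`),
verbatim and route-file-free, from "window average ⇒ penalised THERMAL average at ONE coupling of the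
window"** (`forall_groundState_bound_of_penalisedThermalAverage` fed into the socket
`birEveryGroundState_structural_of_transfer`). The hypothesis is a finite-`β` statement about the
sector Gibbs state of the κ-penalised Hamiltonian — engine currency — and no genericity of ground
multiplets is involved. B. Simon (1993) §II.13; Scalapino (1995) §2. [folklore] -/
theorem birEveryGroundState_structural_of_penalisedThermalAverage
    (h : ∀ (δ U₁ U₂ c : ℝ), δ ∈ Set.Ioo (0:ℝ) (1/2) → 0 < U₁ → U₁ < U₂ → 0 < c →
      (∀ U ∈ Set.Ioo U₁ U₂, ∃ L₀ : ℕ, ∀ (L : ℕ) [NeZero L], L₀ ≤ L → Even L →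
        let N : ℕ := 2 * ⌊(1 - δ) * (L : ℝ) ^ 2 / 2⌋₊
        let H := hubbardTorus 2 L 1 U
        let S := szSector (Λ := FermionTorus 2 L) N 0
        let E₀ := S ⊓ Module.End.eigenspace (Matrix.toLin' H) ((H.minEnergyOn S : ℝ) : ℂ)
        let P := projMatrix (E₀.map (Fock.toEuclidean (ι := Orb (FermionTorus 2 L)) :
          Fock (Orb (FermionTorus 2 L)) →ₗ[ℂ] EuclideanSpace ℂ (Finset (Orb (FermionTorus 2 L)))))
        c * (L : ℝ) ^ 4 * P.trace.re ≤
          (P * ((pairField dWaveFormFactor L)ᴴ * pairField dWaveFormFactor L)).trace.re) →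
      ∃ U ∈ Set.Ioo U₁ U₂, ∃ a : ℝ, 0 < a ∧ ∃ L₀ : ℕ, ∀ (L : ℕ) [NeZero L], L₀ ≤ L → Even L →
        ∃ κ β : ℝ, 0 < κ ∧ 0 < β ∧
        let N : ℕ := 2 * ⌊(1 - δ) * (L : ℝ) ^ 2 / 2⌋₊
        let H := hubbardTorus 2 L 1 U
        let S := szSector (Λ := FermionTorus 2 L) N 0
        let PS := projMatrix (S.map (Fock.toEuclidean (ι := Orb (FermionTorus 2 L)) :
          Fock (Orb (FermionTorus 2 L)) →ₗ[ℂ] EuclideanSpace ℂ (Finset (Orb (FermionTorus 2 L)))))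
        let Yd : Matrix (Finset (Orb (FermionTorus 2 L))) (Finset (Orb (FermionTorus 2 L))) ℂ :=
          ((1 : ℂ) / (L : ℂ) ^ 4) • ((pairField dWaveFormFactor L)ᴴ * pairField dWaveFormFactor L)
        a + (L : ℝ) ^ 2 * Real.log 4 / (β * κ) ≤
          (PS * gibbsWeight β (H + (κ : ℂ) • Yd) * Yd).trace.re /
            (PS * gibbsWeight β (H + (κ : ℂ) • Yd)).trace.re) :
    ∀ (δ U₁ U₂ c : ℝ), δ ∈ Set.Ioo (0:ℝ) (1/2) → 0 < U₁ → U₁ < U₂ → 0 < c → (∀ U ∈ Set.Ioo U₁ U₂, ∃ L₀ : ℕ, ∀ (L : ℕ) [NeZero L], L₀ ≤ L → Even L → let N : ℕ := 2 * ⌊(1 - δ) * (L : ℝ) ^ 2 / 2⌋₊; let H := Literature.MathematicalPhysics.QuantumLattice.hubbardTorus 2 L 1 U; let S := Literature.MathematicalPhysics.QuantumLattice.szSector (Λ := Literature.MathematicalPhysics.QuantumLattice.FermionTorus 2 L) N 0; let E₀ := S ⊓ Module.End.eigenspace (Matrix.toLin' H) ((H.minEnergyOn S : ℝ) : ℂ);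 let P := Literature.MathematicalPhysics.QuantumLattice.projMatrix (E₀.map (Literature.MathematicalPhysics.QuantumLattice.Fock.toEuclidean (ι := Literature.MathematicalPhysics.QuantumLattice.Orb (Literature.MathematicalPhysics.QuantumLattice.FermionTorus 2 L)) : Literature.MathematicalPhysics.QuantumLattice.Fock (Literature.MathematicalPhysics.QuantumLattice.Orb (Literature.MathematicalPhysics.QuantumLattice.FermionTorus 2 L)) →ₗ[ℂ] EuclideanSpace ℂ (Finset (Literature.MathematicalPhysics.QuantumLattice.Orb (Literature.MathematicalPhysics.QuantumLattice.FermionTorus 2 L))))); c * (L : ℝ) ^ 4 * P.trace.re ≤ (P * (Matrix.conjTranspose (Literature.MathematicalPhysics.QuantumLattice.pairField Literature.MathematicalPhysics.QuantumLattice.dWaveFormFactor L) * Literature.MathematicalPhysics.QuantumLattice.pairField Literature.MathematicalPhysics.QuantumLattice.dWaveFormFactor L)).trace.re) → ∃ U ∈ Set.Ioo U₁ U₂, ∀ (N : ℕ → ℕ) (ψ : ∀ L, Literature.MathematicalPhysics.QuantumLattice.Fock (Literature.MathematicalPhysics.QuantumLattice.Orb (Literature.MathematicalPhysics.QuantumLattice.FermionTorus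 2 L))), (∀ L, Even L → N L = 2 * ⌊(1 - δ) * (L : ℝ) ^ 2 / 2⌋₊ ∧ star (ψ L) ⬝ᵥ ψ L = 1 ∧ Literature.MathematicalPhysics.QuantumLattice.IsGroundStateInSector (Literature.MathematicalPhysics.QuantumLattice.hubbardTorus 2 L 1 U) (N L) 0 (ψ L)) → Literature.Probability.LatticeModels.HasLongRangeOrder (fun k => Literature.Probability.LatticeModels.halfOpenBox 2 (2 * k)) (fun k => Literature.MathematicalPhysics.QuantumLattice.torusPullback (Literature.MathematicalPhysics.QuantumLattice.pairFieldCorr Literature.MathematicalPhysics.QuantumLattice.dWaveFormFactor ψ) (2 * k)) := by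
  refine birEveryGroundState_structural_of_transfer fun δ U₁ U₂ c hδ hU₁ hU₁₂ hc hyp => ?_
  obtain ⟨U, hU, a, ha, L₀, hL₀⟩ := h δ U₁ U₂ c hδ hU₁ hU₁₂ hc hyp
  exact ⟨U, hU, a, ha, L₀,
    forall_groundState_bound_of_penalisedThermalAverage U δ a L₀ hL₀⟩

/-- **The engine-facing re-cut: a thermal pair-intensity lower bound in the κ-penalised canonical
ensemble at ONE `(δ, U)` gives the summit.** If for some hole doping `δ ∈ (0, 1/2)` and repulsion
`U > 0` there are `a > 0` and `L₀` such that at every even side `L ≥ L₀` some `κ, β > 0` have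
`a + L² log 4 / (βκ) ≤ ⟨Y_L⟩_{β,κ}` — the sector Gibbs average of `Y_L = L⁻⁴ Δ_d† Δ_d` in the ensemble
of `hubbardTorus 2 L 1 U + κ Y_L`, sector `(2⌊(1-δ)L²/2⌋, S^z = 0)` — then `HubbardSuperconductivity`
holds (`hasLRO_of_penalisedThermalAverage`). Typical use: one fixed `κ ∈ (0, κ_c)` and
`β_L = L² log 4 / (κ a)`, with the engine bound `⟨Y_L⟩_{β_L,κ} ≥ 2a`. Conditional on its hypothesis
(nothing about the Hubbard model is proved here). B. Simon (1993) §II.13; Scalapino (1995) §2.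
[folklore] -/
theorem hubbardSuperconductivity_of_penalisedThermalAverage
    (h : ∃ δ ∈ Set.Ioo (0:ℝ) (1/2), ∃ U : ℝ, 0 < U ∧ ∃ a : ℝ, 0 < a ∧ ∃ L₀ : ℕ,
      ∀ (L : ℕ) [NeZero L], L₀ ≤ L → Even L → ∃ κ β : ℝ, 0 < κ ∧ 0 < β ∧
      let N : ℕ := 2 * ⌊(1 - δ) * (L : ℝ) ^ 2 / 2⌋₊
      let H := hubbardTorus 2 L 1 U
      let S := szSector (Λ := FermionTorus 2 L) N 0
      let PS := projMatrix (S.map (Fock.toEuclidean (ι := Orb (FermionTorus 2 L)) :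
        Fock (Orb (FermionTorus 2 L)) →ₗ[ℂ] EuclideanSpace ℂ (Finset (Orb (FermionTorus 2 L)))))
      let Yd : Matrix (Finset (Orb (FermionTorus 2 L))) (Finset (Orb (FermionTorus 2 L))) ℂ :=
        ((1 : ℂ) / (L : ℂ) ^ 4) • ((pairField dWaveFormFactor L)ᴴ * pairField dWaveFormFactor L)
      a + (L : ℝ) ^ 2 * Real.log 4 / (β * κ) ≤
        (PS * gibbsWeight β (H + (κ : ℂ) • Yd) * Yd).trace.re /
          (PS * gibbsWeight β (H + (κ : ℂ) • Yd)).trace.re) :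
    _root_.HubbardSuperconductivity := by
  obtain ⟨δ, hδ, U, hU, a, ha, L₀, hL₀⟩ := h
  show Literature.Hubbard.DWaveSuperconductivityHubbard
  exact ⟨U, hU, δ, hδ, hasLRO_of_penalisedThermalAverage U δ (by linarith [hδ.1]) ⟨a, ha, L₀, hL₀⟩⟩

/-- **Registered form** (sub-goal `penalisedThermalAverageSummit` of item
`stmt-HubbardSuperconductivity-2083`): `hubbardSuperconductivity_of_penalisedThermalAverage` as a
closed implication. [folklore] -/
theorem penalisedThermalAverageSummit : (∃ δ ∈ Set.Ioo (0:ℝ) (1/2), ∃ U : ℝ, 0 < U ∧ ∃ a : ℝ, 0 < a ∧ ∃ L₀ : ℕ, ∀ (L : ℕ) [NeZero L], L₀ ≤ L → Even L → ∃ κ β : ℝ, 0 < κ ∧ 0 < β ∧ let N : ℕ := 2 * ⌊(1 - δ) * (L : ℝ) ^ 2 / 2⌋₊; let H := Literature.MathematicalPhysics.QuantumLattice.hubbardTorus 2 L 1 U; let S := Literature.MathematicalPhysics.QuantumLattice.szSector (Λ := Literature.MathematicalPhysics.QuantumLattice.FermionTorus 2 L) N 0; let PS := Literature.MathematicalPhysics.QuantumLattice.projMatrix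 (S.map (Literature.MathematicalPhysics.QuantumLattice.Fock.toEuclidean (ι := Literature.MathematicalPhysics.QuantumLattice.Orb (Literature.MathematicalPhysics.QuantumLattice.FermionTorus 2 L)) : Literature.MathematicalPhysics.QuantumLattice.Fock (Literature.MathematicalPhysics.QuantumLattice.Orb (Literature.MathematicalPhysics.QuantumLattice.FermionTorus 2 L)) →ₗ[ℂ] EuclideanSpace ℂ (Finset (Literature.MathematicalPhysics.QuantumLattice.Orb (Literature.MathematicalPhysics.QuantumLattice.FermionTorus 2 L))))); let Yd : Matrix (Finset (Literature.MathematicalPhysics.QuantumLattice.Orb (Literature.MathematicalPhysics.QuantumLattice.FermionTorus 2 L))) (Finset (Literature.MathematicalPhysics.QuantumLattice.Orb (Literature.MathematicalPhysics.QuantumLattice.FermionTorus 2 L))) ℂ := ((1 : ℂ) / (L : ℂ) ^ 4) • (Matrix.conjTranspose (Literature.MathematicalPhysics.QuantumLattice.pairField Literature.MathematicalPhysics.QuantumLattice.dWaveFormFactor L) * Literature.MathematicalPhysics.QuantumLattice.pairField Literature.MathematicalPhysics.QuantumLattice.dWaveFormFactor L); a + (L : ℝ) ^ 2 * Real.log 4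 / (β * κ) ≤ (PS * Matrix.gibbsWeight β (H + (κ : ℂ) • Yd) * Yd).trace.re / (PS * Matrix.gibbsWeight β (H + (κ : ℂ) • Yd)).trace.re) → HubbardSuperconductivity :=
  fun h => hubbardSuperconductivity_of_penalisedThermalAverage h

end Hubbard

end Summit.HubbardSuperconductivity.HubbardSuperconductivity.Theorems
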